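import Literature.Computability.Complexity.NPClosureProofs
import HarnessLib

/-!
# `UP` is closed under polynomial-time many-one reductions

Valiant's class `UP` (`Nondeterministic.lean`: `NP` with at most one accepted certificate per
input) is closed downward under Karp reductions: if `f ∈ FP` and `L ∈ UP` then `f⁻¹(L) ∈ UP`.
The witness language is the one used for `NP` (`preimage_mem_polyExists`, Arora–Barak 2009,
Thm. 2.8): `mapFst(f)⁻¹(LenLe p ⊓ L')` with certificate bound `p ∘ s` for an output-length
bound `s` of `f`; the accepted certificates of `x` for the new verifier are exactly the accepted
certificates of `f x` for the old one, so uniqueness transfers. This is the routine half of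
"`UP` has many-one complete sets iff …" discussions (Hartmanis–Hemachandra; Hemaspaandra–Rothe
1997, §1) and the step `padded language ∈ UP ⇒ language ∈ UP` of every padding argument for
unambiguous time classes.

* `preimage_mem_UP` — `L ∈ UP → f ∈ FP → f ⁻¹' L ∈ UP`;
* `mem_UP_of_karpReducible` — `L₁ ≤ₚ L₂ → L₂ ∈ UP → L₁ ∈ UP`.

References: L. G. Valiant, *Relative complexity of checking and evaluating*, Inform. Process.
Lett. 5 (1976) 20–23 [Valiant1976]; S. Arora, B. Barak, *Computational Complexity: A Modern
Approach* (2009), Thm. 2.8 [AroraBarakCC2009]; L. Hemaspaandra, J. Rothe, *Unambiguous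
computation: Boolean hierarchies and sparse Turing-complete sets*, SIAM J. Comput. 26 (1997),
§1 [HemaspaandraRothe1997]. Standard axioms only.
-/

namespace Literature.Computability.Complexity

open _root_.Computability Polynomial
open scoped Notation

/-- **`UP` is closed under polynomial-time preimages.** For `L ∈ UP` with `P`-verifier language
`L'` and bound `p`, and `f ∈ FP` with output-length bound `s`, the language
`mapFst(f)⁻¹(LenLe p ⊓ L') ∈ P` with bound `p ∘ s` verifies `f⁻¹(L)`, and its accepted
certificates at `x` are among the accepted certificates of `L'` at `f x` — at most one.
[cite: Valiant1976] [cite: AroraBarakCC2009, Thm. 2.8 (the NP case; uniqueness is preserved)] -/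
theorem preimage_mem_UP {L : Language Bool} (hL : L ∈ UP) {f : List Bool → List Bool}
    (hf : f ∈ FP) : f ⁻¹' L ∈ UP := by
  obtain ⟨L', hL', p, hp, hU⟩ := hL
  obtain ⟨s, hs⟩ := exists_poly_length_le_of_mem_FP hf
  have hmem : ∀ x y : List Bool, boolPair x y ∈ mapFstFn f ⁻¹' (LenLe p ⊓ L') ↔
      y.length ≤ p.eval (f x).length ∧ boolPair (f x) y ∈ L' := fun x y => by
    change mapFstFn f (boolPair x y) ∈ LenLe p ∧ mapFstFn f (boolPair x y) ∈ L' ↔ _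
    rw [mapFstFn_boolPair, boolPair_mem_LenLe]
  refine ⟨mapFstFn f ⁻¹' (LenLe p ⊓ L'),
    preimage_mem_P (inter_mem_P (LenLe_mem_P p) hL') (mapFstFn_mem_FP hf), p.comp s,
    fun x => ?_, fun x => ?_⟩
  · change f x ∈ L ↔ _
    rw [hp (f x)]
    constructor
    · rintro ⟨y, hy, hyL⟩
      refine ⟨y, hy.trans ?_, (hmem x y).2 ⟨hy, hyL⟩⟩
      rw [eval_comp]
      exact TM2Iter.eval_mono p (hs x)
    · rintro ⟨y, -, hy⟩
      exact ⟨y, ((hmem x y).1 hy).1, ((hmem x y).1 hy).2⟩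
  · intro y₁ hy₁ y₂ hy₂
    exact hU (f x) ((hmem x y₁).1 hy₁.2) ((hmem x y₂).1 hy₂.2)

/-- **If `L₁ ≤ₚ L₂` and `L₂ ∈ UP` then `L₁ ∈ UP`** (`UP` is closed downward under Karp
reductions). [cite: Valiant1976] [cite: AroraBarakCC2009, Thm. 2.8 (NP case)] -/
theorem mem_UP_of_karpReducible {L₁ L₂ : Language Bool} (h : L₁ ≤ₚ L₂) (h₂ : L₂ ∈ UP) :
    L₁ ∈ UP := by
  obtain ⟨f, hf, hfL⟩ := h
  have hpre : L₁ = f ⁻¹' L₂ := Set.ext hfL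
  rw [hpre]
  exact preimage_mem_UP h₂ hf

end Literature.Computability.Complexity
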